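import Literature.Analysis.FluidPDE.KNSSLiouvillePlanar
import HarnessLib

/-!
# Stub `stub_divFormLiouville` of the line `Ideator2Sketch` (card `flux-surface-persistence`)
# (crux `IsobaricLinesLiouville`, stmt-NavierStokesRegularity-11741, route `IsobarTomography`)

**Divergence-form Liouville theorem for the drift–heat equation** — the `n`-dimensional core of
the proof of Koch–Nadirashvili–Seregin–Šverák 2009, Theorem 5.1 (arXiv:0709.3599, p. 9), ported
from the tree's planar version (`Literature.Analysis.FluidPDE.curl2_nonpos_of_lemma21`,
`curl2_eq_zero_of_lemma21`, `KNSSPlanarVorticity.curl2_mass_le`, `false_of_curl2_ge_on_balls`)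
with "`f = curl2 v`, `v` bounded" replaced by "`f = div F`, `F` bounded":

* (`divForm_abs_integral_divergence_mul_le`) the surface estimate
  `|∫ (div F) χ| = |∫ ⟪F, ∇χ⟫| ≤ K ∫ ‖Dχ‖` for `F ∈ C¹`, `‖F‖ ≤ K`, `χ ∈ C¹_c`
  (`integral_mul_divergence_add_eq_zero_left`, whole-space integration by parts);
* (`divForm_mass_le`) with the rescaled cut-offs `χ_R = χ₁(·/R)` (`cutoff R`,
  `∫ χ_R = Rⁿ ∫ χ₁`, `∫ ‖Dχ_R‖ = Rⁿ⁻¹ ∫ ‖Dχ₁‖`): `div F ≥ m` on `B(0, 2R)` forces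
  `m R ∫χ₁ ≤ K ∫‖Dχ₁‖`, so (`divForm_false_of_ge_on_balls`) no `m > 0` admits such fields on
  balls of every radius;
* (`divForm_nonpos`) a bounded `f` in the elementary class of KNSS's Lemma 2.1
  (`KNSS2009_lemma21_halfball`, proved in the tree for every finite-dimensional inner product
  space: `KNSS2009_lemma21_halfball_holds`) whose slices are divergences of `C¹` fields bounded
  by `K` is `≤ 0`: otherwise `sup f = M₁ > 0` and Lemma 2.1 produces balls of every radius on
  which `f ≥ M₁ / 2`;
* (`stub_divFormLiouville`) applied to `f` and to `−f = div (−F)` (same drift, the equation being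
  linear), `f ≡ 0` on `ℝ³ × (−∞, 0)`.

## References

* G. Koch, N. Nadirashvili, G. Seregin, V. Šverák, *Liouville theorems for the Navier–Stokes
  equations and applications*, Acta Math. 203 (2009) 83–105 = arXiv:0709.3599: Lemma 2.1
  (p. 5), Theorem 5.1 and its proof (p. 9). [KochNadirashviliSereginSverak2009]
-/

-- the summit and its single problem share the name (D-0017 nested layout)
set_option linter.dupNamespace false

noncomputable section

namespace Summit.NavierStokesRegularity.NavierStokesRegularity.Theorems.IsobaricLinesLiouville.FluxSurfacePersistence

open MeasureTheory Set Function Filter TopologicalSpace InnerProductSpace Metric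
open scoped RealInnerProductSpace Laplacian ContDiff Topology NNReal
open Literature.Analysis.FluidPDE Literature.Analysis

/-! ## The surface estimate `|∫ (div F) χ| ≤ K ∫ ‖Dχ‖` and its consequence on large balls -/
section Flux

variable {E : Type*} [NormedAddCommGroup E] [InnerProductSpace ℝ E] [FiniteDimensional ℝ E]
  [MeasurableSpace E] [BorelSpace E]

omit [FiniteDimensional ℝ E] [MeasurableSpace E] [BorelSpace E] in
/-- `div (−F) = −div F` (pointwise; `D(−F) = −DF` and linearity of the trace). [folklore] -/
theorem divForm_divergence_neg (F : E → E) (x : E) :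
    VectorCalculus.divergence (fun y => -F y) x = -VectorCalculus.divergence F x := by
  rw [VectorCalculus.divergence, VectorCalculus.divergence, fderiv_fun_neg,
    ContinuousLinearMap.toLinearMap_neg, map_neg]

omit [FiniteDimensional ℝ E] [MeasurableSpace E] [BorelSpace E] in
/-- The divergence commutes with translations: `div (F(· + a)) x = (div F)(x + a)`. [folklore] -/
theorem divForm_divergence_comp_add_right (F : E → E) (a x : E) :
    VectorCalculus.divergence (fun y => F (y + a)) x = VectorCalculus.divergence F (x + a) := by
  rw [VectorCalculus.divergence, fderiv_comp_add_right, VectorCalculus.divergence]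

/-- **Surface estimate**: `|∫ (div F) χ| ≤ K ∫ ‖Dχ‖` for `F ∈ C¹(E; E)` with `‖F‖ ≤ K` and
`χ ∈ C¹_c(E)` (whole-space integration by parts `∫ χ div F = −∫ ⟪F, ∇χ⟫`,
`integral_mul_divergence_add_eq_zero_left`, and `|⟪F, ∇χ⟫| ≤ K ‖Dχ‖`; the smooth counterpart of
KNSS's `∫_{B_R} ω dx = ∫_{∂B_R} (u₂n₁ − u₁n₂) ds ≤ C R` in the proof of Theorem 5.1). [cite: KochNadirashviliSereginSverak2009, proof of Thm 5.1, surface-integral estimate (arXiv p. 9)] -/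
theorem divForm_abs_integral_divergence_mul_le {F : E → E} (hF : ContDiff ℝ 1 F) {K : ℝ}
    (hK : ∀ x, ‖F x‖ ≤ K) {χ : E → ℝ} (hχ : ContDiff ℝ 1 χ) (hc : HasCompactSupport χ) :
    |∫ x, VectorCalculus.divergence F x * χ x| ≤ K * ∫ x, ‖fderiv ℝ χ x‖ := by
  have h := integral_mul_divergence_add_eq_zero_left hχ hF hc
  have h1 : ∫ x, VectorCalculus.divergence F x * χ x = -∫ x, ⟪F x, gradient χ x⟫ := by
    have : ∫ x, VectorCalculus.divergence F x * χ x =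
        ∫ x, χ x * VectorCalculus.divergence F x :=
      integral_congr_ae (Eventually.of_forall fun x => mul_comm _ _)
    linarith
  rw [h1, abs_neg]
  have hpt : ∀ x, |⟪F x, gradient χ x⟫| ≤ K * ‖fderiv ℝ χ x‖ := fun x => by
    have hg : ‖gradient χ x‖ = ‖fderiv ℝ χ x‖ := by
      rw [gradient, LinearIsometryEquiv.norm_map]
    calc |⟪F x, gradient χ x⟫| ≤ ‖F x‖ * ‖gradient χ x‖ := abs_real_inner_le_norm _ _
      _ ≤ K * ‖fderiv ℝ χ x‖ := by
          rw [hg]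
          exact mul_le_mul_of_nonneg_right (hK x) (norm_nonneg _)
  calc |∫ x, ⟪F x, gradient χ x⟫| ≤ ∫ x, |⟪F x, gradient χ x⟫| := abs_integral_le_integral_abs
    _ ≤ ∫ x, K * ‖fderiv ℝ χ x‖ := by
        refine integral_mono_of_nonneg (Eventually.of_forall fun x => abs_nonneg _) ?_
          (Eventually.of_forall hpt)
        exact ((hχ.continuous_fderiv one_ne_zero).norm.integrable_of_hasCompactSupport
          (hc.fderiv (𝕜 := ℝ)).norm).const_mul _
    _ = K * ∫ x, ‖fderiv ℝ χ x‖ := integral_const_mul _ _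

/-- **Mass bound with the rescaled cut-offs.** Let `F ∈ C¹(E; E)` with `‖F‖ ≤ K`, and suppose
`div F ≥ m` on the ball `‖x‖ < 2R`. With `χ_R = χ₁(·/R)` (`cutoff R`: `= 1` on `B_R`, supported
in `B_{2R}`, `0 ≤ χ_R ≤ 1`) and `n = dim E`:
`m Rⁿ ∫χ₁ = m ∫χ_R ≤ ∫ (div F) χ_R ≤ K ∫‖Dχ_R‖ = K Rⁿ⁻¹ ∫‖Dχ₁‖` (scaling of Lebesgue measure,
`Dχ_R = R⁻¹ Dχ₁(·/R)`), i.e. `m R ∫χ₁ ≤ K ∫‖Dχ₁‖` — KNSS's comparison of the volume estimate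
`∫_{Q_R} ω ≳ M₁ Rⁿ⁺²` with the surface estimate `∫_{Q_R} ω ≤ C Rⁿ⁺¹` (p. 9), on one time slice
and with a smooth cut-off. [cite: KochNadirashviliSereginSverak2009, proof of Thm 5.1, volume vs surface estimates (arXiv p. 9)] -/
theorem divForm_mass_le {F : E → E} (hF : ContDiff ℝ 1 F) {K : ℝ} (hK : ∀ x, ‖F x‖ ≤ K)
    {R m : ℝ} (hR : 0 < R) (hm : ∀ x : E, ‖x‖ < 2 * R → m ≤ VectorCalculus.divergence F x) :
    m * R * ∫ x, (FunctionSpaces.dyadicCutoff E : E → ℝ) x ≤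
      K * ∫ x, ‖fderiv ℝ (FunctionSpaces.dyadicCutoff E : E → ℝ) x‖ := by
  set χ₁ : E → ℝ := (FunctionSpaces.dyadicCutoff E : E → ℝ) with hχ₁_def
  set χ : E → ℝ := cutoff R with hχ_def
  have hχc : ContDiff ℝ 1 χ := contDiff_cutoff R
  have hχs : HasCompactSupport χ := hasCompactSupport_cutoff hR
  set n : ℕ := Module.finrank ℝ E with hn
  -- (1) mass of the cut-off: `∫ χ_R = Rⁿ ∫ χ₁`
  have hmass : ∫ x, χ x = R ^ n * ∫ x, χ₁ x := by
    have h := Measure.integral_comp_inv_smul_of_nonneg volume χ₁ hR.le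
    rw [smul_eq_mul] at h
    exact h
  -- (2) mass of its gradient: `∫ ‖Dχ_R‖ = R⁻¹ Rⁿ ∫ ‖Dχ₁‖`
  have hgrad : ∫ x, ‖fderiv ℝ χ x‖ = R⁻¹ * (R ^ n * ∫ x, ‖fderiv ℝ χ₁ x‖) := by
    have hpt : ∀ x, ‖fderiv ℝ χ x‖ = R⁻¹ * ‖fderiv ℝ χ₁ (R⁻¹ • x)‖ := by
      intro x
      have : fderiv ℝ χ x = R⁻¹ • fderiv ℝ χ₁ (R⁻¹ • x) :=
        fderiv_comp_smul (𝕜 := ℝ) (f := χ₁) (x := x) R⁻¹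
      rw [this, norm_smul, norm_inv, Real.norm_of_nonneg hR.le]
    simp_rw [hpt]
    rw [integral_const_mul]
    have h := Measure.integral_comp_inv_smul_of_nonneg volume (fun x => ‖fderiv ℝ χ₁ x‖) hR.le
    rw [smul_eq_mul] at h
    rw [h]
  -- (3) lower bound: `m ∫ χ_R ≤ ∫ (div F) χ_R`
  have hdc : Continuous (VectorCalculus.divergence F) :=
    continuous_divergence (hF.continuous_fderiv one_ne_zero)
  have hint1 : Integrable (fun x => m * χ x) :=
    (hχc.continuous.integrable_of_hasCompactSupport hχs).const_mul m
  have hint2 : Integrable (fun x => VectorCalculus.divergence F x * χ x) :=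
    (hdc.mul hχc.continuous).integrable_of_hasCompactSupport hχs.mul_left
  have hlow : m * ∫ x, χ x ≤ ∫ x, VectorCalculus.divergence F x * χ x := by
    rw [← integral_const_mul]
    refine integral_mono hint1 hint2 fun x => ?_
    by_cases hx : ‖x‖ < 2 * R
    · exact mul_le_mul_of_nonneg_right (hm x hx) (cutoff_nonneg R x)
    · have : χ x = 0 := cutoff_eq_zero hR (not_lt.1 hx)
      simp [this]
  -- (4) upper bound: `∫ (div F) χ_R ≤ K ∫ ‖Dχ_R‖`
  have hup : ∫ x, VectorCalculus.divergence F x * χ x ≤ K * ∫ x, ‖fderiv ℝ χ x‖ :=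
    (le_abs_self _).trans (divForm_abs_integral_divergence_mul_le hF hK hχc hχs)
  -- combine and rescale by `R / Rⁿ`
  have key : m * (R ^ n * ∫ x, χ₁ x) ≤ K * (R⁻¹ * (R ^ n * ∫ x, ‖fderiv ℝ χ₁ x‖)) := by
    rw [← hmass, ← hgrad]
    exact hlow.trans hup
  have hP : 0 < R ^ n := pow_pos hR n
  have h1 := mul_le_mul_of_nonneg_left key (div_pos hR hP).le
  calc m * R * ∫ x, χ₁ x = R / R ^ n * (m * (R ^ n * ∫ x, χ₁ x)) := by
        field_simp
    _ ≤ R / R ^ n * (K * (R⁻¹ * (R ^ n * ∫ x, ‖fderiv ℝ χ₁ x‖))) := h1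
    _ = K * ∫ x, ‖fderiv ℝ χ₁ x‖ := by
        field_simp

/-- **The surface estimate against large balls, as a contradiction.** There is no `m > 0` such
that for every radius `R` some field `F ∈ C¹(E; E)` with `‖F‖ ≤ K` has `div F ≥ m` on a ball of
radius `R`: translate the ball to the origin (`div` commutes with translations) and let `R → ∞`
in `divForm_mass_le` (`m R ∫χ₁ ≤ K ∫‖Dχ₁‖` with `∫χ₁ > 0`). KNSS p. 9: "Clearly [the volume
estimate] is not compatible with [the surface estimate], unless `M₁ ≤ 0`." [cite: KochNadirashviliSereginSverak2009, proof of Thm 5.1, volume vs surface estimates (arXiv p. 9)] -/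
theorem divForm_false_of_ge_on_balls {K m : ℝ} (hm : 0 < m)
    (h : ∀ R > 0, ∃ (F : E → E) (y₀ : E), ContDiff ℝ 1 F ∧ (∀ x, ‖F x‖ ≤ K) ∧
      ∀ x ∈ ball y₀ R, m ≤ VectorCalculus.divergence F x) : False := by
  set I : ℝ := ∫ x, (FunctionSpaces.dyadicCutoff E : E → ℝ) x with hI_def
  set J : ℝ := ∫ x, ‖fderiv ℝ (FunctionSpaces.dyadicCutoff E : E → ℝ) x‖ with hJ_def
  have hI : 0 < I := (FunctionSpaces.dyadicCutoff E).integral_pos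
  have hJ : 0 ≤ J := integral_nonneg fun x => norm_nonneg _
  have hK0 : 0 ≤ K := by
    obtain ⟨F, y₀, -, hK, -⟩ := h 1 one_pos
    exact (norm_nonneg _).trans (hK 0)
  -- a radius beyond the bound
  set R : ℝ := K * J / (m * I) + 1 with hR_def
  have hR0 : 0 ≤ K * J / (m * I) := div_nonneg (by positivity) (by positivity)
  have hR : 0 < R := by linarith
  obtain ⟨F, y₀, hF, hK, hdiv⟩ := h (2 * R) (by linarith)
  -- translate the ball to the origin
  set G : E → E := fun x => F (x + y₀) with hG_def
  have hG : ContDiff ℝ 1 G := hF.comp (contDiff_id.add contDiff_const)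
  have hGK : ∀ x, ‖G x‖ ≤ K := fun x => hK _
  have hGm : ∀ x : E, ‖x‖ < 2 * R → m ≤ VectorCalculus.divergence G x := by
    intro x hx
    rw [hG_def, divForm_divergence_comp_add_right]
    exact hdiv _ (by rwa [mem_ball, dist_eq_norm, add_sub_cancel_right])
  have key := divForm_mass_le hG hGK hR hGm
  -- `m R I ≤ K J` contradicts the choice of `R`
  have h1 : R ≤ K * J / (m * I) := by
    rw [le_div_iff₀ (mul_pos hm hI)]
    calc R * (m * I) = m * R * I := by ring
      _ ≤ K * J := key
  linarith

end Flux

/-! ## Lemma 2.1 against the surface estimate -/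
section Nonpos

variable {E : Type*} [NormedAddCommGroup E] [InnerProductSpace ℝ E] [FiniteDimensional ℝ E]
  [MeasurableSpace E] [BorelSpace E]

/-- **A divergence in the class of Lemma 2.1 is nonpositive.** Let `f : ℝ → E → ℝ` satisfy the
hypotheses of `KNSS2009_lemma21_halfball` on `E × (−∞, 0)` (bounded, `C²` slices, bounded and
jointly continuous `Df`, `Δf`, the integrated drift–diffusion equation with a bounded measurable
drift `a`), and suppose every slice `f(t, ·)`, `t < 0`, is the divergence `div F` of some `C¹`
field with `‖F‖ ≤ K`. Then `f ≤ 0`: if `M₁ = sup f > 0` (the supremum as `sSup` of the bounded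
set of values), Lemma 2.1 (`KNSS2009_lemma21_halfball_holds`) gives balls of every radius with
`f ≥ M₁/2` at some time, incompatible with the surface estimate
(`divForm_false_of_ge_on_balls`). KNSS 2009, proof of Theorem 5.1, p. 9, with `curl` replaced by
`div`. [cite: KochNadirashviliSereginSverak2009, proof of Thm 5.1 (arXiv p. 9)] -/
theorem divForm_nonpos {f : ℝ → E → ℝ} {a : ℝ → E → E} {A K : ℝ} (ha : Measurable (uncurry a))
    (haA : ∀ t < 0, ∀ y, ‖a t y‖ ≤ A) (hfb : ∃ C : ℝ, ∀ t < 0, ∀ y, |f t y| ≤ C)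
    (hf2 : ∀ t < 0, ContDiff ℝ 2 (f t))
    (hfD : ∃ C : ℝ, ∀ t < 0, ∀ y, ‖fderiv ℝ (f t) y‖ ≤ C ∧ |(Δ (f t)) y| ≤ C)
    (hcD : ContinuousOn (fun p : ℝ × E => fderiv ℝ (f p.1) p.2) (Iio 0 ×ˢ univ))
    (hcΔ : ContinuousOn (fun p : ℝ × E => (Δ (f p.1)) p.2) (Iio 0 ×ˢ univ))
    (heq : ∀ y, ∀ s t : ℝ, s ≤ t → t < 0 →
      f t y - f s y = ∫ τ in s..t, ((Δ (f τ)) y - fderiv ℝ (f τ) y (a τ y)))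
    (hrep : ∀ t < 0, ∃ F : E → E, ContDiff ℝ 1 F ∧ (∀ y, ‖F y‖ ≤ K) ∧
      ∀ y, f t y = VectorCalculus.divergence F y) :
    ∀ t < 0, ∀ y, f t y ≤ 0 := by
  by_contra hcon
  push Not at hcon
  obtain ⟨t₀, ht₀, y₀, hy₀⟩ := hcon
  obtain ⟨C, hC⟩ := hfb
  -- the set of values of `f` on the slab, its supremum `M₁`
  set S : Set ℝ := (fun p : ℝ × E => f p.1 p.2) '' (Iio (0 : ℝ) ×ˢ (univ : Set E)) with hS
  have hbdd : BddAbove S := by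
    refine ⟨C, ?_⟩
    rintro r ⟨⟨t, y⟩, ⟨ht, -⟩, rfl⟩
    exact (le_abs_self _).trans (hC t ht y)
  have hmem : ∀ t < 0, ∀ y, f t y ∈ S := fun t ht y => ⟨(t, y), ⟨ht, mem_univ _⟩, rfl⟩
  have hne : S.Nonempty := ⟨_, hmem t₀ ht₀ y₀⟩
  set M₁ : ℝ := sSup S with hM₁
  have hle : ∀ t < 0, ∀ y, f t y ≤ M₁ := fun t ht y => le_csSup hbdd (hmem t ht y)
  have hpos : 0 < M₁ := hy₀.trans_le (hle t₀ ht₀ y₀)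
  have happ : ∀ ε > 0, ∃ t < 0, ∃ y, M₁ - ε < f t y := by
    intro ε hε
    obtain ⟨r, ⟨⟨t, y⟩, ⟨ht, -⟩, rfl⟩, hr⟩ :=
      exists_lt_of_lt_csSup hne (by linarith : M₁ - ε < sSup S)
    exact ⟨t, ht, y, hr⟩
  -- Lemma 2.1 (proved in the tree in every finite dimension): half-balls of every radius
  have H := KNSS2009_lemma21_halfball_holds (E := E) ha haA ⟨C, hC⟩ hf2 hfD hcD hcΔ heq hle
    happ hpos
  -- the surface estimate forbids them
  refine divForm_false_of_ge_on_balls (E := E) (K := K) (half_pos hpos) fun R hR => ?_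
  obtain ⟨y₁, t₁, ht₁, hball⟩ := H R hR
  have ht₂ : t₁ - R ^ 2 / 2 ∈ Ioo (t₁ - R ^ 2) t₁ := by
    constructor <;> nlinarith [sq_nonneg R, hR]
  have ht₂' : t₁ - R ^ 2 / 2 < 0 := by nlinarith [sq_nonneg R]
  obtain ⟨F, hF, hFK, hfF⟩ := hrep _ ht₂'
  refine ⟨F, y₁, hF, hFK, fun x hx => ?_⟩
  rw [← hfF x]
  exact hball _ ht₂ x hx

end Nonpos

/-! ## The registered stub -/

/-- **Divergence-form Liouville for the drift–heat equation** (the engine of hull (E); the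
n-dimensional core of the proof of KNSS 2009 Thm 5.1, here on `ℝ³`): a bounded scalar `f` on
`ℝ³ × (−∞,0)` in the class of KNSS Lemma 2.1 (`C²` slices, bounded and jointly continuous `Df`,
`Δf`, the equation `fₜ + a·∇f − Δf = 0` with a bounded measurable drift `a`, integrated in time)
whose every slice is the divergence of a `C¹` field bounded by `K` vanishes identically:
`divForm_nonpos` for `f` (`f ≤ 0`) and for `−f` (same drift, the equation being linear;
`−f(t, ·) = div (−F)` with `‖−F‖ ≤ K`), as in KNSS p. 9: "`M₁ ≤ 0` … In the same way we
conclude that `M₂ ≥ 0` and therefore `ω` must vanish identically". [cite: KochNadirashviliSereginSverak2009, proof of Thm 5.1 (arXiv p. 9)] -/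
theorem stub_divFormLiouville :
    ∀ (f : ℝ → (EuclideanSpace ℝ (Fin 3)) → ℝ) (a : ℝ → (EuclideanSpace ℝ (Fin 3)) → (EuclideanSpace ℝ (Fin 3))) (A K : ℝ),
      Measurable (uncurry a) → (∀ t < 0, ∀ y, ‖a t y‖ ≤ A) →
      (∃ C : ℝ, ∀ t < 0, ∀ y, |f t y| ≤ C) →
      (∀ t < 0, ContDiff ℝ 2 (f t)) →
      (∃ C : ℝ, ∀ t < 0, ∀ y, ‖fderiv ℝ (f t) y‖ ≤ C ∧ |(Δ (f t)) y| ≤ C) →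
      ContinuousOn (fun p : ℝ × (EuclideanSpace ℝ (Fin 3)) => fderiv ℝ (f p.1) p.2) (Set.Iio 0 ×ˢ Set.univ) →
      ContinuousOn (fun p : ℝ × (EuclideanSpace ℝ (Fin 3)) => (Δ (f p.1)) p.2) (Set.Iio 0 ×ˢ Set.univ) →
      (∀ y, ∀ s t : ℝ, s ≤ t → t < 0 →
        f t y - f s y = ∫ τ in s..t, ((Δ (f τ)) y - fderiv ℝ (f τ) y (a τ y))) →
      (∀ t < 0, ∃ F : (EuclideanSpace ℝ (Fin 3)) → (EuclideanSpace ℝ (Fin 3)),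
        ContDiff ℝ 1 F ∧ (∀ y, ‖F y‖ ≤ K) ∧ ∀ y, f t y = VectorCalculus.divergence F y) →
      ∀ t < 0, ∀ y, f t y = 0 := by
  intro f a A K ha haA hfb hf2 hfD hcD hcΔ heq hrep
  -- `f ≤ 0`
  have hle : ∀ t < 0, ∀ y, f t y ≤ 0 := divForm_nonpos ha haA hfb hf2 hfD hcD hcΔ heq hrep
  -- `−f ≤ 0`: the same for `−f = div (−F)` with the same drift
  set g : ℝ → EuclideanSpace ℝ (Fin 3) → ℝ := fun t => -(f t) with hg
  have hg2 : ∀ t < 0, ContDiff ℝ 2 (g t) := fun t ht => (hf2 t ht).neg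
  have hgb : ∃ C : ℝ, ∀ t < 0, ∀ y, |g t y| ≤ C := by
    obtain ⟨C, hC⟩ := hfb
    exact ⟨C, fun t ht y => by simpa [hg, abs_neg] using hC t ht y⟩
  have hgD : ∃ C : ℝ, ∀ t < 0, ∀ y, ‖fderiv ℝ (g t) y‖ ≤ C ∧ |(Δ (g t)) y| ≤ C := by
    obtain ⟨C, hC⟩ := hfD
    refine ⟨C, fun t ht y => ?_⟩
    simp only [hg, fderiv_neg, norm_neg, laplacian_neg, Pi.neg_apply, abs_neg]
    exact hC t ht y
  have hcgD : ContinuousOn (fun p : ℝ × EuclideanSpace ℝ (Fin 3) => fderiv ℝ (g p.1) p.2)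
      (Iio 0 ×ˢ univ) := by
    have : (fun p : ℝ × EuclideanSpace ℝ (Fin 3) => fderiv ℝ (g p.1) p.2) =
        fun p => -fderiv ℝ (f p.1) p.2 := by
      funext p; simp [hg, fderiv_neg]
    rw [this]
    exact hcD.neg
  have hcgΔ : ContinuousOn (fun p : ℝ × EuclideanSpace ℝ (Fin 3) => (Δ (g p.1)) p.2)
      (Iio 0 ×ˢ univ) := by
    have : (fun p : ℝ × EuclideanSpace ℝ (Fin 3) => (Δ (g p.1)) p.2) =
        fun p => -(Δ (f p.1)) p.2 := by
      funext p; simp [hg, laplacian_neg]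
    rw [this]
    exact hcΔ.neg
  have hgeq : ∀ y, ∀ s t : ℝ, s ≤ t → t < 0 →
      g t y - g s y = ∫ τ in s..t, ((Δ (g τ)) y - fderiv ℝ (g τ) y (a τ y)) := by
    intro y s t hst ht
    have h := heq y s t hst ht
    have hpt : (fun τ => (Δ (g τ)) y - fderiv ℝ (g τ) y (a τ y)) =
        fun τ => -((Δ (f τ)) y - fderiv ℝ (f τ) y (a τ y)) := by
      funext τ
      have h1 : Δ (g τ) = -(Δ (f τ)) := by rw [hg]; exact laplacian_neg
      have h2 : fderiv ℝ (g τ) y = -fderiv ℝ (f τ) y := by rw [hg]; exact fderiv_neg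
      rw [h1, h2]
      simp only [Pi.neg_apply, neg_apply]
      ring
    rw [hpt, intervalIntegral.integral_neg, ← h]
    simp only [hg, Pi.neg_apply]
    ring
  have hgrep : ∀ t < 0, ∃ F : EuclideanSpace ℝ (Fin 3) → EuclideanSpace ℝ (Fin 3),
      ContDiff ℝ 1 F ∧ (∀ y, ‖F y‖ ≤ K) ∧ ∀ y, g t y = VectorCalculus.divergence F y := by
    intro t ht
    obtain ⟨F, hF, hFK, hfF⟩ := hrep t ht
    refine ⟨fun y => -F y, hF.neg, fun y => by simpa [norm_neg] using hFK y, fun y => ?_⟩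
    rw [divForm_divergence_neg, ← hfF y]
    simp [hg]
  have hle' : ∀ t < 0, ∀ y, g t y ≤ 0 :=
    divForm_nonpos ha haA hgb hg2 hgD hcgD hcgΔ hgeq hgrep
  -- conclude
  intro t ht y
  have h1 := hle t ht y
  have h2 := hle' t ht y
  simp only [hg, Pi.neg_apply, neg_nonpos] at h2
  exact le_antisymm h1 h2

end Summit.NavierStokesRegularity.NavierStokesRegularity.Theorems.IsobaricLinesLiouville.FluxSurfacePersistence

end
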